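import Summits.Ventures.PercRepro.RankLevelSetBiIndepPerElem

/-! # RankLevelSetBiIndepSum — THE BI-INDEPENDENT SETS OF A DIRECT SUM ARE THE PAIRS; THE MARKED COUNTS CONVOLVE
(night-1 g24; dossier §36.9 b)

For disjoint matroids `M, N` (`Matroid.disjointSum`), a set `S` is bi-independent in `M ⊕ N` iff its two traces
`S ∩ E_M`, `S ∩ E_N` are bi-independent in `M`, `N`. Hence, for any predicate `P` on the `M`-trace,
`#{S ∈ D_r(M ⊕ N) : P (S ∩ E_M)} = Σ_{a ≤ r} #{S₁ ∈ D_a(M) : P S₁} · D_{r−a}(N)` (`ncard_biIndep_disjointSum_filter`);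
in particular (`y ∈ E_M`) the marked counts of the per-element inequality (★★) convolve with the profile of `N`:
`#{Q ∈ D_{j+1}(M ⊕ N) : y ∈ Q} = Σ_{a ≤ j} #{Q₁ ∈ D_{a+1}(M) : y ∈ Q₁} · D_{j−a}(N)` and
`#{Z ∈ D_j(M ⊕ N) : y ∉ Z} = Σ_{a ≤ j} #{Z₁ ∈ D_a(M) : y ∉ Z₁} · D_{j−a}(N)`
(`ncard_mem_biIndep_disjointSum`, `ncard_not_mem_biIndep_disjointSum`). Also the complementation of the marked counts
inside one matroid: `#{Q ∈ D_{a+1} : y ∈ Q} = #{Z ∈ D_{n−1−a} : y ∉ Z}` (`ncard_mem_biIndep_eq_not_mem_compl`), and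
the vanishing of the marked counts beyond the ground set. Used by `RankLevelSetBiIndepSumPerElem` (the class of
matroids satisfying (★★) is closed under direct sums). Axioms: standard. -/

namespace PercRepro

open Set Matroid

variable {α : Type} {M N : Matroid α} [M.Finite] [N.Finite] {h : Disjoint M.E N.E}

/-! ## Bi-independence in a disjoint sum -/

omit [M.Finite] [N.Finite] in
/-- A set of the disjoint sum is bi-independent iff its two traces are: the `M`-trace in `M` and the `N`-trace
in `N` (with the sizes adding up). -/
lemma mem_biIndep_disjointSum_iff {r : ℕ} {S : Set α} :
    S ∈ biIndep (M.disjointSum N h) r ↔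
      S ⊆ M.E ∪ N.E ∧ S.ncard = r ∧
        (S ∩ M.E ∈ biIndep M (S ∩ M.E).ncard) ∧ (S ∩ N.E ∈ biIndep N (S ∩ N.E).ncard) := by
  have e₁ : (M.E ∪ N.E) \ S ∩ M.E = M.E \ (S ∩ M.E) := by
    ext x; simp only [Set.mem_inter_iff, Set.mem_sdiff, Set.mem_union]; tauto
  have e₂ : (M.E ∪ N.E) \ S ∩ N.E = N.E \ (S ∩ N.E) := by
    ext x; simp only [Set.mem_inter_iff, Set.mem_sdiff, Set.mem_union]; tauto
  constructor
  · rintro ⟨hS, hr, hind, hind'⟩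
    rw [Matroid.disjointSum_ground_eq] at hS hind'
    rw [Matroid.disjointSum_indep_iff] at hind hind'
    obtain ⟨hM, hN, -⟩ := hind
    obtain ⟨hM', hN', -⟩ := hind'
    rw [e₁] at hM'
    rw [e₂] at hN'
    exact ⟨hS, hr, ⟨Set.inter_subset_right, rfl, hM, hM'⟩, ⟨Set.inter_subset_right, rfl, hN, hN'⟩⟩
  · rintro ⟨hS, hr, ⟨-, -, hM, hM'⟩, ⟨-, -, hN, hN'⟩⟩
    refine ⟨?_, hr, ?_, ?_⟩
    · rw [Matroid.disjointSum_ground_eq]; exact hS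
    · rw [Matroid.disjointSum_indep_iff]; exact ⟨hM, hN, hS⟩
    · rw [Matroid.disjointSum_ground_eq, Matroid.disjointSum_indep_iff, e₁, e₂]
      exact ⟨hM', hN', Set.sdiff_subset⟩

omit [M.Finite] [N.Finite] in
/-- The size of a subset of `E_M ∪ E_N` is the sum of the sizes of its traces. -/
lemma ncard_eq_ncard_inter_add_ncard_inter (h : Disjoint M.E N.E) {S : Set α} (hS : S ⊆ M.E ∪ N.E)
    (hfin : S.Finite) :
    S.ncard = (S ∩ M.E).ncard + (S ∩ N.E).ncard := by
  have hdisj : Disjoint (S ∩ M.E) (S ∩ N.E) :=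
    Set.disjoint_of_subset Set.inter_subset_right Set.inter_subset_right h
  have e : S = (S ∩ M.E) ∪ (S ∩ N.E) := by
    rw [← Set.inter_union_distrib_left, Set.inter_eq_self_of_subset_left hS]
  conv_lhs => rw [e]
  exact Set.ncard_union_eq hdisj (hfin.inter_of_left _) (hfin.inter_of_left _)

/-! ## The convolution -/

/-- **The bi-independent `r`-sets of `M ⊕ N` whose `M`-trace satisfies `P`, counted by the size of the trace**:
`Σ_{a ≤ r} #{S₁ ∈ D_a(M) : P S₁} · D_{r−a}(N)`. -/
theorem ncard_biIndep_disjointSum_filter (P : Set α → Prop) (r : ℕ) :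
    {S ∈ biIndep (M.disjointSum N h) r | P (S ∩ M.E)}.ncard =
      ∑ a ∈ Finset.range (r + 1), {S₁ ∈ biIndep M a | P S₁}.ncard * (biIndep N (r - a)).ncard := by
  classical
  haveI : (M.disjointSum N h).Finite :=
    ⟨by rw [Matroid.disjointSum_ground_eq]; exact M.ground_finite.union N.ground_finite⟩
  set 𝒮 : Set (Set α) := {S ∈ biIndep (M.disjointSum N h) r | P (S ∩ M.E)} with h𝒮
  have h𝒮fin : 𝒮.Finite := (biIndep_finite _ r).subset (fun S hS => hS.1)
  -- fiberwise by the size of the `M`-trace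
  have hmaps : ∀ S ∈ h𝒮fin.toFinset, (S ∩ M.E).ncard ∈ Finset.range (r + 1) := by
    intro S hS
    rw [h𝒮fin.mem_toFinset] at hS
    obtain ⟨hSE, hr, -, -⟩ := mem_biIndep_disjointSum_iff.mp hS.1
    rw [Finset.mem_range, Nat.lt_succ_iff, ← hr]
    exact Set.ncard_le_ncard Set.inter_subset_left ((M.ground_finite.union N.ground_finite).subset hSE)
  rw [Set.ncard_eq_toFinset_card 𝒮 h𝒮fin, Finset.card_eq_sum_card_fiberwise hmaps]
  refine Finset.sum_congr rfl (fun a ha => ?_)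
  rw [Finset.mem_range, Nat.lt_succ_iff] at ha
  -- the fiber `a` is in bijection with the product
  rw [← Set.ncard_coe_finset, ← Set.ncard_prod]
  refine Set.ncard_congr (fun S _ => (S ∩ M.E, S ∩ N.E)) ?_ ?_ ?_
  · intro S hS
    obtain ⟨hS1, hSa⟩ := Finset.mem_filter.mp (Finset.mem_coe.mp hS)
    obtain ⟨hSbi, hP⟩ := h𝒮fin.mem_toFinset.mp hS1
    obtain ⟨hSE, hr, hM, hN⟩ := mem_biIndep_disjointSum_iff.mp hSbi
    have hsplit := ncard_eq_ncard_inter_add_ncard_inter h hSE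
      ((M.ground_finite.union N.ground_finite).subset hSE)
    refine Set.mem_prod.mpr ⟨⟨?_, hP⟩, ?_⟩
    · rw [← hSa]; exact hM
    · have : (S ∩ N.E).ncard = r - a := by omega
      rw [← this]; exact hN
  · intro S S' hS hS' hSS'
    simp only [Prod.mk.injEq] at hSS'
    obtain ⟨hS1, -⟩ := Finset.mem_filter.mp (Finset.mem_coe.mp hS)
    obtain ⟨hS'1, -⟩ := Finset.mem_filter.mp (Finset.mem_coe.mp hS')
    obtain ⟨hSE, -, -, -⟩ := mem_biIndep_disjointSum_iff.mp (h𝒮fin.mem_toFinset.mp hS1).1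
    obtain ⟨hS'E, -, -, -⟩ := mem_biIndep_disjointSum_iff.mp (h𝒮fin.mem_toFinset.mp hS'1).1
    ext x
    constructor
    · intro hx
      rcases hSE hx with hxM | hxN
      · have hx' : x ∈ S' ∩ M.E := hSS'.1 ▸ ⟨hx, hxM⟩
        exact hx'.1
      · have hx' : x ∈ S' ∩ N.E := hSS'.2 ▸ ⟨hx, hxN⟩
        exact hx'.1
    · intro hx
      rcases hS'E hx with hxM | hxN
      · have hx' : x ∈ S ∩ M.E := hSS'.1.symm ▸ ⟨hx, hxM⟩
        exact hx'.1
      · have hx' : x ∈ S ∩ N.E := hSS'.2.symm ▸ ⟨hx, hxN⟩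
        exact hx'.1
  · rintro ⟨S₁, S₂⟩ hpair
    rw [Set.mem_prod] at hpair
    obtain ⟨⟨hS₁bi, hP⟩, hS₂bi⟩ := hpair
    obtain ⟨hS₁E, hS₁card, hS₁ind, hS₁cind⟩ := hS₁bi
    obtain ⟨hS₂E, hS₂card, hS₂ind, hS₂cind⟩ := hS₂bi
    have hdisj : Disjoint S₁ S₂ := Set.disjoint_of_subset hS₁E hS₂E h
    have e₁ : (S₁ ∪ S₂) ∩ M.E = S₁ := by
      rw [Set.union_inter_distrib_right, Set.inter_eq_self_of_subset_left hS₁E,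
        (Set.disjoint_of_subset_left hS₂E h.symm).inter_eq, Set.union_empty]
    have e₂ : (S₁ ∪ S₂) ∩ N.E = S₂ := by
      rw [Set.union_inter_distrib_right, Set.inter_eq_self_of_subset_left hS₂E,
        (Set.disjoint_of_subset_left hS₁E h).inter_eq, Set.empty_union]
    refine ⟨S₁ ∪ S₂, ?_, ?_⟩
    · rw [Finset.mem_coe, Finset.mem_filter, h𝒮fin.mem_toFinset]
      refine ⟨⟨?_, by rw [e₁]; exact hP⟩, by rw [e₁]; exact hS₁card⟩
      rw [mem_biIndep_disjointSum_iff]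
      refine ⟨Set.union_subset_union hS₁E hS₂E, ?_, ?_, ?_⟩
      · rw [Set.ncard_union_eq hdisj (M.ground_finite.subset hS₁E) (N.ground_finite.subset hS₂E), hS₁card, hS₂card]
        omega
      · rw [e₁]; exact ⟨hS₁E, rfl, hS₁ind, hS₁cind⟩
      · rw [e₂]; exact ⟨hS₂E, rfl, hS₂ind, hS₂cind⟩
    · simp only [e₁, e₂]

/-- **The marked count through `y ∈ E_M` convolves**: `#{Q ∈ D_{j+1}(M ⊕ N) : y ∈ Q} = Σ_{a ≤ j} #{Q₁ ∈ D_{a+1}(M) : y ∈ Q₁} · D_{j−a}(N)`. -/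
theorem ncard_mem_biIndep_disjointSum {y : α} (hy : y ∈ M.E) (j : ℕ) :
    {Q ∈ biIndep (M.disjointSum N h) (j + 1) | y ∈ Q}.ncard =
      ∑ a ∈ Finset.range (j + 1), {Q₁ ∈ biIndep M (a + 1) | y ∈ Q₁}.ncard * (biIndep N (j - a)).ncard := by
  have e : {Q ∈ biIndep (M.disjointSum N h) (j + 1) | y ∈ Q} =
      {Q ∈ biIndep (M.disjointSum N h) (j + 1) | y ∈ Q ∩ M.E} := by
    ext Q; simp only [Set.mem_setOf_eq, Set.mem_inter_iff]; tauto
  rw [e, ncard_biIndep_disjointSum_filter (h := h) (fun T => y ∈ T) (j + 1), Finset.sum_range_succ']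
  have h0 : {S₁ ∈ biIndep M 0 | y ∈ S₁}.ncard = 0 := by
    rw [Set.ncard_eq_zero ((biIndep_finite M 0).subset (fun S hS => hS.1))]
    ext S
    simp only [Set.mem_setOf_eq, Set.mem_empty_iff_false, iff_false, not_and]
    intro hS hyS
    have hfin : S.Finite := M.ground_finite.subset hS.1
    have : S.ncard ≠ 0 := Set.ncard_ne_zero_of_mem hyS hfin
    exact this hS.2.1
  rw [h0, zero_mul, add_zero]
  refine Finset.sum_congr rfl (fun a _ => ?_)
  rw [show j + 1 - (a + 1) = j - a by omega]

/-- **The marked count avoiding `y ∈ E_M` convolves**: `#{Z ∈ D_j(M ⊕ N) : y ∉ Z} = Σ_{a ≤ j} #{Z₁ ∈ D_a(M) : y ∉ Z₁} · D_{j−a}(N)`. -/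
theorem ncard_not_mem_biIndep_disjointSum {y : α} (hy : y ∈ M.E) (j : ℕ) :
    {Z ∈ biIndep (M.disjointSum N h) j | y ∉ Z}.ncard =
      ∑ a ∈ Finset.range (j + 1), {Z₁ ∈ biIndep M a | y ∉ Z₁}.ncard * (biIndep N (j - a)).ncard := by
  have e : {Z ∈ biIndep (M.disjointSum N h) j | y ∉ Z} =
      {Z ∈ biIndep (M.disjointSum N h) j | y ∉ Z ∩ M.E} := by
    ext Z; simp only [Set.mem_setOf_eq, Set.mem_inter_iff]; tauto
  rw [e]
  exact ncard_biIndep_disjointSum_filter (h := h) (fun T => y ∉ T) j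

/-! ## Complementation and vanishing of the marked counts in one matroid -/

variable (M)

/-- **Complementation of the marked counts**: `#{Q ∈ D_{a+1} : y ∈ Q} = #{Z ∈ D_{n−1−a} : y ∉ Z}` for `a + 1 ≤ n`. -/
theorem ncard_mem_biIndep_eq_not_mem_compl {y : α} (hy : y ∈ M.E) {a : ℕ} (ha : a + 1 ≤ M.E.ncard) :
    {Q ∈ biIndep M (a + 1) | y ∈ Q}.ncard = {Z ∈ biIndep M (M.E.ncard - 1 - a) | y ∉ Z}.ncard := by
  refine Set.ncard_congr (fun Q _ => M.E \ Q) ?_ ?_ ?_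
  · rintro Q ⟨hQ, hyQ⟩
    refine ⟨?_, fun hy' => hy'.2 hyQ⟩
    have := mem_biIndep_compl M hQ
    rwa [show M.E.ncard - (a + 1) = M.E.ncard - 1 - a by omega] at this
  · rintro Q Q' ⟨hQ, -⟩ ⟨hQ', -⟩ hQQ'
    have e : M.E \ (M.E \ Q) = M.E \ (M.E \ Q') := by rw [hQQ']
    rwa [Set.sdiff_sdiff_cancel_left hQ.1, Set.sdiff_sdiff_cancel_left hQ'.1] at e
  · rintro Z ⟨hZ, hyZ⟩
    refine ⟨M.E \ Z, ⟨?_, ⟨hy, hyZ⟩⟩, Set.sdiff_sdiff_cancel_left hZ.1⟩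
    have := mem_biIndep_compl M hZ
    rwa [show M.E.ncard - (M.E.ncard - 1 - a) = a + 1 by omega] at this

/-- There are no bi-independent sets larger than the ground set: `D_r = 0` for `r > #E`. -/
theorem biIndep_eq_empty_of_lt {r : ℕ} (hr : M.E.ncard < r) : biIndep M r = ∅ := by
  ext S
  simp only [Set.mem_empty_iff_false, iff_false]
  rintro ⟨hSE, hcard, -, -⟩
  have := Set.ncard_le_ncard hSE M.ground_finite
  omega

/-- A bi-independent set avoiding `y ∈ E` has at most `#E − 1` elements. -/
theorem ncard_not_mem_biIndep_eq_zero {y : α} (hy : y ∈ M.E) {a : ℕ} (ha : M.E.ncard ≤ a) :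
    {Z ∈ biIndep M a | y ∉ Z}.ncard = 0 := by
  rw [Set.ncard_eq_zero ((biIndep_finite M a).subset (fun S hS => hS.1))]
  ext Z
  simp only [Set.mem_setOf_eq, Set.mem_empty_iff_false, iff_false, not_and]
  rintro ⟨hZE, hcard, -, -⟩ hyZ
  have hsub : Z ⊆ M.E \ {y} := fun x hx => ⟨hZE hx, fun hxy => hyZ (hxy ▸ hx)⟩
  have h1 := Set.ncard_le_ncard hsub (M.ground_finite.subset Set.sdiff_subset)
  rw [Set.ncard_sdiff' (Set.singleton_subset_iff.mpr hy) M.ground_finite, Set.ncard_singleton] at h1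
  have hpos : 0 < M.E.ncard := (Set.ncard_pos M.ground_finite).mpr ⟨y, hy⟩
  omega

end PercRepro
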